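import Mathlib
import Summits.ValiantsHypothesis.ValiantsHypothesis.Theorems.FifoMatchingNNLinearDegreeCofactorHardQueueTransfer
import Summits.ValiantsHypothesis.ValiantsHypothesis.Theorems.FifoMatchingNNLinearDegreeCofactorHardQueueLineageS
import HarnessLib

/-!
# Crux `NNLinearDegreeCofactorHard` (stmt-ValiantsHypothesis-23918), line `internal_cofactor`: the growth bound of one
# generation counted against S-BOUNDARIES and the plain S-band (unit U3 of (D*), aligned with the LEAD's pricing)

`…QueueTransfer.growth_le` bounds the growth of the alive `b`-S-items over a generation by the tests plus a REG term over the
stretches between ALL front-colour changes.  The LEAD's pricing (`Lines/internal_cofactor-S2b-Dstar3-attribution-p2.md`) pays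
for passages of S-BLOCKS (maximal equal-colour runs of S-items, R-items skipped: S-predecessor `Nat.findGreatest`, as in
`…QueueLineageS`), and the successor surplus is best priced by the plain S-BAND (`sPush − sPop ≤ D` on every window, `D = 2m`).
This file is that version, with `isS` marking the S-items (instantiate `…QueueTransfer` with `isR := fun k => !isS k`):

* `changesS` — times in `(u, v)` at which a NEW S-front arrives whose colour differs from its S-predecessor's;
  `card_changesS_le_sboundaries` — at most the S-boundaries inside `alive(T)` during a generation;
* `sfront_colour_eq` — with no such time inside `(u, v)`, all S-fronts of `[u, v)` have one colour
  (`QueueHistory.exists_sboundary_between`);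
* `stretchS_le` — hence `bPush − bPop ≤ (n + 1)·D` on a window with `≤ n` S-changes (induction on the last one), under
  NS («an S-push has an S-front») and the band;
* `growthS_le` — **`Z_b(gen T) ≤ Z_b(T) + tests[T, gen T) + D·(#S-boundaries inside alive(T) + 1)`**.

Deterministic; nothing here proves S2b, the crux or VP ≠ VNP (not proved). [folklore]
-/

-- Sub = Summit single-conjunct layout: the duplicated namespace component is mandated by the tree.
set_option linter.dupNamespace false

namespace Summit.ValiantsHypothesis.ValiantsHypothesis.Theorems.FifoMatching.NNLinearDegreeCofactorHard.QueueHistory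

open Finset
open Summit.ValiantsHypothesis.ValiantsHypothesis.Theorems.FifoMatching.NNMonotoneHard

/-- S-CHANGE times strictly inside `(u, v)`: a new front arrives (`rC` steps) which is an S-item whose colour differs from its
S-predecessor's. [folklore] -/
def changesS (σ : ℕ → Bool) (rC o : ℕ → ℕ) (isS : ℕ → Bool) (u v : ℕ) : ℕ :=
  ((Ioo u v).filter fun s => rC s ≠ rC (s - 1) ∧ isS (rC s) = true ∧
    σ (o (rC s)) ≠ σ (o (Nat.findGreatest (fun n => isS n = true) (rC s - 1)))).card

section AbstractQueue

variable {W σ : ℕ → Bool} {rO rC o c : ℕ → ℕ} {n' : ℕ} {isS : ℕ → Bool}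
variable (hOs : ∀ t, rO (t + 1) = rO t + (if W t = true then 1 else 0))
  (hCs : ∀ t, rC (t + 1) = rC t + (if W t = true then 0 else 1))
  (ho : ∀ k t, k < n' → (o k < t ↔ k < rO t))
  (hc : ∀ k t, k < n' → (c k < t ↔ k < rC t))

include hCs in
/-- A new front means one pop: `rC s = rC (s−1) + 1`. [folklore] -/
theorem rankC_eq_succ_of_ne {s : ℕ} (hs : 1 ≤ s) (hne : rC s ≠ rC (s - 1)) : rC s = rC (s - 1) + 1 := by
  have h := hCs (s - 1)
  rw [Nat.sub_add_cancel hs] at h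
  by_cases hW : W (s - 1) = true
  · rw [hW, if_pos rfl, add_zero] at h; exact absurd h hne
  · rw [if_neg hW] at h; exact h

include hCs hc in
/-- **S-changes during `(T, gen T)` are at most the S-boundaries inside `alive(T)`.** [folklore] -/
theorem card_changesS_le_sboundaries {T : ℕ} (hne : rC T < rO T) (hnT : rO T ≤ n') :
    changesS σ rC o isS T (gen c rO T) ≤
      ((Ioo (rC T) (rO T)).filter fun k => isS k = true ∧
        σ (o k) ≠ σ (o (Nat.findGreatest (fun n => isS n = true) (k - 1)))).card := by
  classical
  unfold changesS
  rw [← card_image_of_injOn (f := rC)]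
  · refine card_le_card fun k hk => ?_
    rw [mem_image] at hk
    obtain ⟨s, hs, rfl⟩ := hk
    rw [mem_filter, mem_Ioo] at hs ⊢
    obtain ⟨⟨hTs, hsG⟩, hstep, hS, hch⟩ := hs
    have hstep' := rankC_eq_succ_of_ne hCs (by omega) hstep
    have hprev : rC T ≤ rC (s - 1) := rankC_mono hCs (by omega)
    have hcur : rC s < rO T := (rankC_mem_of_lt_gen hCs hc hne hnT (le_of_lt hTs) hsG).2
    exact ⟨⟨by omega, hcur⟩, hS, hch⟩
  · intro s₁ h₁ s₂ h₂ heq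
    have h₁' := mem_filter.1 (mem_coe.1 h₁); have h₂' := mem_filter.1 (mem_coe.1 h₂)
    have e₁ := rankC_eq_succ_of_ne hCs (by have := (mem_Ioo.1 h₁'.1).1; omega) h₁'.2.1
    have e₂ := rankC_eq_succ_of_ne hCs (by have := (mem_Ioo.1 h₂'.1).1; omega) h₂'.2.1
    by_contra hne'
    rcases Nat.lt_or_gt_of_ne hne' with h | h
    · have := rankC_mono hCs (show s₁ ≤ s₂ - 1 by omega); omega
    · have := rankC_mono hCs (show s₂ ≤ s₁ - 1 by omega); omega

include hCs hc in
/-- **With no S-change inside `(u, v)` (within a generation), all S-fronts of `[u, v)` have one colour.** [folklore] -/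
theorem sfront_colour_eq {T u v : ℕ} (hne : rC T < rO T) (hnT : rO T ≤ n') (hTu : T ≤ u) (hvG : v ≤ gen c rO T)
    (h0 : changesS σ rC o isS u v = 0) {s₁ s₂ : ℕ} (hu₁ : u ≤ s₁) (h₁₂ : s₁ ≤ s₂) (h₂v : s₂ < v)
    (hS₁ : isS (rC s₁) = true) (hS₂ : isS (rC s₂) = true) : σ (o (rC s₁)) = σ (o (rC s₂)) := by
  classical
  by_contra hcol
  set k₁ := rC s₁ with hk₁
  set k₂ := rC s₂ with hk₂
  have hk₁₂ : k₁ ≤ k₂ := rankC_mono hCs h₁₂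
  rcases hk₁₂.eq_or_lt with heq | hlt
  · exact hcol (by simp only [hk₁, hk₂] at heq ⊢; rw [heq])
  obtain ⟨j', hj1, hj2, hjS, _, hjcol⟩ := exists_sboundary_between isS (fun k => σ (o k)) hS₁ k₂ hlt hS₂ hcol
  -- `j'` arrives at the front at time `s' = c (j' - 1) + 1 ∈ (s₁, s₂] ⊆ (u, v)`: an S-change, contradiction
  have hk₂n : k₂ < n' := lt_of_lt_of_le
    (rankC_mem_of_lt_gen hCs hc hne hnT (hTu.trans (hu₁.trans h₁₂)) (lt_of_lt_of_le h₂v hvG)).2 hnT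
  have hj'n : j' - 1 < n' := by omega
  set s' := c (j' - 1) + 1 with hs'
  have hrC' : rC s' = j' := by rw [hs', rankC_closer_succ hCs hc hj'n]; omega
  have hrCp : rC (s' - 1) = j' - 1 := by
    rw [hs', Nat.add_sub_cancel]; exact (rankC_closer hCs hc hj'n).1
  -- `s₁ < s'`: at `s₁` the front is `k₁ < j'`
  have hs₁s' : s₁ < s' := by
    by_contra hle; push Not at hle
    have := rankC_mono hCs hle; omega
  -- `s' ≤ s₂`: at `s₂` the front is `k₂ ≥ j'`, i.e. item `j' - 1` was popped before `s₂`
  have hs's₂ : s' ≤ s₂ := by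
    have : c (j' - 1) < s₂ := (hc (j' - 1) s₂ hj'n).2 (by omega)
    omega
  unfold changesS at h0
  rw [card_eq_zero, filter_eq_empty_iff] at h0
  refine h0 (x := s') (mem_Ioo.2 ⟨lt_of_le_of_lt hu₁ hs₁s', lt_of_le_of_lt hs's₂ h₂v⟩) ⟨by omega, by rw [hrC']; exact hjS, ?_⟩
  rw [hrC']; exact hjcol

include hCs hc in
/-- **One S-stretch.**  On a window `[u, v)` of a generation with no S-change inside, under NS (every S-push has an S-front)
and the S-band (`sPush − sPop ≤ D` on every sub-window), the `b`-front S-pushes exceed the `b`-front S-pops by at most `D`.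
[folklore] -/
theorem stretchS_base (b : Bool) {T u v D : ℕ} (hne : rC T < rO T) (hnT : rO T ≤ n') (hTu : T ≤ u) (huv : u ≤ v)
    (hvG : v ≤ gen c rO T)
    (hNS : ∀ t, T ≤ t → t < gen c rO T → W t = true → isS (rO t) = true → isS (rC t) = true)
    (hband : ∀ u' v', T ≤ u' → u' ≤ v' → v' ≤ gen c rO T →
      sPush W rO (fun k => !isS k) u' v' ≤ sPop W rC (fun k => !isS k) u' v' + D)
    (h0 : changesS σ rC o isS u v = 0) :
    bPush W σ rO rC o (fun k => !isS k) b u v ≤ bPop W σ rC o (fun k => !isS k) b u v + D := by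
  classical
  by_cases hex : ∃ s, u ≤ s ∧ s < v ∧ isS (rC s) = true ∧ σ (o (rC s)) = b
  · -- all S-fronts of the window have colour `b`: the `b`-front counts are the plain counts
    obtain ⟨s₀, hus₀, hs₀v, hS₀, hb₀⟩ := hex
    have hall : ∀ s, u ≤ s → s < v → isS (rC s) = true → σ (o (rC s)) = b := by
      intro s hus hsv hS
      rcases le_total s₀ s with h | h
      · rw [← sfront_colour_eq hCs hc hne hnT hTu hvG h0 hus₀ h hsv hS₀ hS, hb₀]
      · rw [sfront_colour_eq hCs hc hne hnT hTu hvG h0 hus h hs₀v hS hS₀, hb₀]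
    have hP : bPush W σ rO rC o (fun k => !isS k) b u v = sPush W rO (fun k => !isS k) u v := by
      unfold bPush sPush
      congr 1
      refine filter_congr fun t ht => ?_
      constructor
      · rintro ⟨hW, hR, -⟩; exact ⟨hW, hR⟩
      · rintro ⟨hW, hR⟩
        have hS : isS (rO t) = true := by simpa using hR
        exact ⟨hW, hR, hall t (mem_Ico.1 ht).1 (mem_Ico.1 ht).2
          (hNS t (hTu.trans (mem_Ico.1 ht).1) (lt_of_lt_of_le (mem_Ico.1 ht).2 hvG) hW hS)⟩
    have hQ : bPop W σ rC o (fun k => !isS k) b u v = sPop W rC (fun k => !isS k) u v := by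
      unfold bPop sPop
      congr 1
      refine filter_congr fun t ht => ?_
      constructor
      · rintro ⟨hW, hR, -⟩; exact ⟨hW, hR⟩
      · rintro ⟨hW, hR⟩
        have hS : isS (rC t) = true := by simpa using hR
        exact ⟨hW, hR, hall t (mem_Ico.1 ht).1 (mem_Ico.1 ht).2 hS⟩
    rw [hP, hQ]
    exact hband u v hTu huv hvG
  · -- no S-front of colour `b` in the window: both counts vanish
    push Not at hex
    have hP : bPush W σ rO rC o (fun k => !isS k) b u v = 0 := by
      unfold bPush
      rw [card_eq_zero, filter_eq_empty_iff]
      rintro t ht ⟨hW, hR, hb⟩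
      have hS : isS (rO t) = true := by simpa using hR
      exact hex t (mem_Ico.1 ht).1 (mem_Ico.1 ht).2
        (hNS t (hTu.trans (mem_Ico.1 ht).1) (lt_of_lt_of_le (mem_Ico.1 ht).2 hvG) hW hS) hb
    have hQ : bPop W σ rC o (fun k => !isS k) b u v = 0 := by
      unfold bPop
      rw [card_eq_zero, filter_eq_empty_iff]
      rintro t ht ⟨hW, hR, hb⟩
      have hS : isS (rC t) = true := by simpa using hR
      exact hex t (mem_Ico.1 ht).1 (mem_Ico.1 ht).2 hS hb
    rw [hP, hQ]; exact Nat.zero_le _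

include hCs hc in
/-- **S-stretch sum**: with at most `n` S-changes inside `(u, v)`, `bPush ≤ bPop + (n+1)·D` (induction on the LAST S-change).
[folklore] -/
theorem stretchS_le (b : Bool) {T D : ℕ} (hne : rC T < rO T) (hnT : rO T ≤ n')
    (hNS : ∀ t, T ≤ t → t < gen c rO T → W t = true → isS (rO t) = true → isS (rC t) = true)
    (hband : ∀ u' v', T ≤ u' → u' ≤ v' → v' ≤ gen c rO T →
      sPush W rO (fun k => !isS k) u' v' ≤ sPop W rC (fun k => !isS k) u' v' + D) :
    ∀ n u v, T ≤ u → u ≤ v → v ≤ gen c rO T → changesS σ rC o isS u v ≤ n →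
      bPush W σ rO rC o (fun k => !isS k) b u v ≤ bPop W σ rC o (fun k => !isS k) b u v + (n + 1) * D := by
  classical
  intro n
  induction n with
  | zero =>
    intro u v hTu huv hvG hch
    simpa using stretchS_base hCs hc b hne hnT hTu huv hvG hNS hband (Nat.le_zero.1 hch)
  | succ n ih =>
    intro u v hTu huv hvG hch
    by_cases hle : changesS σ rC o isS u v ≤ n
    · exact (ih u v hTu huv hvG hle).trans (by nlinarith)
    · have hpos : 0 < changesS σ rC o isS u v := by omega
      set Dset := (Ioo u v).filter fun s => rC s ≠ rC (s - 1) ∧ isS (rC s) = true ∧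
        σ (o (rC s)) ≠ σ (o (Nat.findGreatest (fun n => isS n = true) (rC s - 1))) with hDset
      have hDne : Dset.Nonempty := by rw [← card_pos]; unfold changesS at hpos; exact hpos
      set d := Dset.max' hDne with hd
      have hdD : d ∈ Dset := max'_mem Dset hDne
      have hud : u < d := (mem_Ioo.1 (mem_filter.1 hdD).1).1
      have hdv : d < v := (mem_Ioo.1 (mem_filter.1 hdD).1).2
      have hch1 : changesS σ rC o isS u d ≤ n := by
        have hsub : ((Ioo u d).filter fun s => rC s ≠ rC (s - 1) ∧ isS (rC s) = true ∧
            σ (o (rC s)) ≠ σ (o (Nat.findGreatest (fun n => isS n = true) (rC s - 1)))) ⊆ Dset.erase d := by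
          intro s hs
          rw [mem_filter, mem_Ioo] at hs
          rw [mem_erase, hDset, mem_filter, mem_Ioo]
          exact ⟨ne_of_lt hs.1.2, ⟨hs.1.1, lt_trans hs.1.2 hdv⟩, hs.2⟩
        have h1 := card_le_card hsub
        rw [card_erase_of_mem hdD] at h1
        have h2 : Dset.card = changesS σ rC o isS u v := rfl
        unfold changesS
        omega
      have hch2 : changesS σ rC o isS d v = 0 := by
        unfold changesS
        rw [card_eq_zero, filter_eq_empty_iff]
        intro s hs h
        have hsD : s ∈ Dset := by
          rw [hDset, mem_filter, mem_Ioo]; rw [mem_Ioo] at hs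
          exact ⟨⟨lt_trans hud hs.1, hs.2⟩, h⟩
        have := le_max' Dset s hsD
        rw [← hd] at this
        exact absurd (mem_Ioo.1 hs).1 (not_lt.2 this)
      have e1 := ih u d hTu (le_of_lt hud) ((le_of_lt hdv).trans hvG) hch1
      have e2 := stretchS_base hCs hc b hne hnT (hTu.trans (le_of_lt hud)) (le_of_lt hdv) hvG hNS hband hch2
      have aP : bPush W σ rO rC o (fun k => !isS k) b u v =
          bPush W σ rO rC o (fun k => !isS k) b u d + bPush W σ rO rC o (fun k => !isS k) b d v := by
        unfold bPush; exact card_filter_Ico_add _ (le_of_lt hud) (le_of_lt hdv)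
      have aQ : bPop W σ rC o (fun k => !isS k) b u v =
          bPop W σ rC o (fun k => !isS k) b u d + bPop W σ rC o (fun k => !isS k) b d v := by
        unfold bPop; exact card_filter_Ico_add _ (le_of_lt hud) (le_of_lt hdv)
      rw [aP, aQ]
      nlinarith [e1, e2]

include hOs hCs ho hc in
/-- **Growth bound against S-boundaries and the S-band (U3 for the LEAD's pricing).**  Over one generation `[T, gen T)`:
`Z_b(gen T) ≤ Z_b(T) + tests + D·(#S-boundaries inside alive(T) + 1)`. [folklore] -/
theorem growthS_le (b : Bool) {T D : ℕ} (hne : rC T < rO T) (hnT : rO T ≤ n') (hnG : rO (gen c rO T) ≤ n')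
    (hNS : ∀ t, T ≤ t → t < gen c rO T → W t = true → isS (rO t) = true → isS (rC t) = true)
    (hband : ∀ u' v', T ≤ u' → u' ≤ v' → v' ≤ gen c rO T →
      sPush W rO (fun k => !isS k) u' v' ≤ sPop W rC (fun k => !isS k) u' v' + D) :
    aliveS σ rO rC o (fun k => !isS k) b (gen c rO T) ≤
      aliveS σ rO rC o (fun k => !isS k) b T + sTests W σ rO rC o (fun k => !isS k) T (gen c rO T) +
        D * (((Ioo (rC T) (rO T)).filter fun k => isS k = true ∧
          σ (o k) ≠ σ (o (Nat.findGreatest (fun n => isS n = true) (k - 1)))).card + 1) := by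
  classical
  set G := gen c rO T with hG
  have hTG : T < G := lt_gen hc hne hnT
  have hpush_n : ∀ t, T ≤ t → t < G → W t = true → rO t < n' := fun t _ ht hW => by
    have h1 : rO (t + 1) ≤ rO G := rankO_mono hOs (Nat.succ_le_of_lt ht)
    rw [hOs, if_pos hW] at h1; omega
  have h1 : aliveS σ rO rC o (fun k => !isS k) b G ≤
      sTests W σ rO rC o (fun k => !isS k) T G + bPush W σ rO rC o (fun k => !isS k) b T G := by
    rw [card_aliveS_gen_eq hOs hCs ho hc b hne hnT hnG]
    exact card_bPush_le (σ := σ) (rC := rC) (isR := fun k => !isS k) hOs ho b hpush_n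
  have h2 := stretchS_le hCs hc (σ := σ) (o := o) b hne hnT hNS hband (changesS σ rC o isS T G) T G le_rfl
    (le_of_lt hTG) le_rfl le_rfl
  have h3 : bPop W σ rC o (fun k => !isS k) b T G ≤ aliveS σ rO rC o (fun k => !isS k) b T :=
    card_bPop_le_aliveS hCs hc b hne hnT
  have h4 := card_changesS_le_sboundaries hCs hc (σ := σ) (o := o) (isS := isS) hne hnT
  have h5 : (changesS σ rC o isS T G + 1) * D ≤
      D * (((Ioo (rC T) (rO T)).filter fun k => isS k = true ∧
        σ (o k) ≠ σ (o (Nat.findGreatest (fun n => isS n = true) (k - 1)))).card + 1) := by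
    rw [mul_comm]; exact Nat.mul_le_mul_left _ (Nat.add_le_add_right h4 1)
  omega

end AbstractQueue

end Summit.ValiantsHypothesis.ValiantsHypothesis.Theorems.FifoMatching.NNLinearDegreeCofactorHard.QueueHistory
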